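import Summits.QuantumFields.GaugeBoot.TwistedTraceLoops
import Summits.QuantumFields.GaugeBoot.SU2SingleTraceClosure
import HarnessLib

/-!
# The holonomy gauge: every link variable becomes the holonomy of a closed word at the base point (gauge-boot, FFT 6/7)

HONEST FRAMING (cell `pub-gaugeboot`, page 1 of every file): the venture produces certified bounds
on lattice expectations at stated coupling, gauge group, dimension and torus size; NOT a mass gap,
NOT a continuum limit, NOT a string tension; NOT Yang–Mills-summit-bearing (barriers
`FixedCouplingUltralocality`, `PerturbativeInvisibility`). Bookkeeping on the torus `(ℤ/L)^d`;
no number is certified. Sixth brick of the lane's first fundamental theorem for lattice gauge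
invariants (the "maximal tree" step of Durhuus 1980 / Creutz Ch. 9, done WITHOUT a tree: any
choice of paths from the base point will do).

## Content (torus `(ℤ/L)^d`, `L ≥ 1`, any topological group `G`, `r : LatticeRep G`)

* `basePath x` — a lattice word from the base point `0` to `x` (the torus is connected by words,
  `exists_word_endpoint`); `pathGauge U x = hol_0(basePath x)(U)` — the HOLONOMY GAUGE
  transformation of the configuration `U`; `edgeLoop e = basePath x · e · (basePath (x+e_i))⁻¹` —
  the closed word at `0` through the link `e = (x, i)`.
* ★ `gaugeTransform_pathGauge_apply` — IN THE HOLONOMY GAUGE EVERY LINK VARIABLE IS A CLOSED-WORD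
  HOLONOMY AT THE BASE POINT: `(U^{pathGauge U})_e = hol_0(edgeLoop e)(U)`.
* `pathGaugeCM` — `U ↦ U^{pathGauge U}` as a continuous self-map of the configurations;
  `comp_pathGaugeCM_eq_of_isGaugeInvariant` — gauge-invariant observables do not see it.
* `entryC r e a b` — the complex matrix entry `U ↦ ρ(U_e)_{ab}`; `polyAlgebraC r` — the unital
  `ℂ`-algebra generated by the entries and their conjugates (the complexification of the tree's
  real `polyAlgebra r`); `lineAlgebraC r x` — the unital `ℂ`-algebra generated by the ENTRIES of
  the holonomies of the closed words at `x` (`lineC`; closed under `star` by unitarity,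
  `star_lineC_of_closed`).
* ★★ `comp_pathGaugeCM_mem_lineAlgebraC` — composing ANY complex polynomial observable with the
  holonomy gauge lands in `lineAlgebraC r 0`: in the holonomy gauge a polynomial in the link
  variables is a polynomial in the entries of closed-word holonomies at the base point.

References: M. Creutz, *Quarks, gluons and lattices* (1983) Ch. 9 (maximal-tree gauge);
B. Durhuus, Lett. Math. Phys. 4 (1980) 515–522. Folklore.
-/

noncomputable section

namespace Summit.QuantumFields.GaugeBoot

open Matrix TensorFFT
open Literature.MathematicalPhysics.QuantumFieldTheory (Site Edge GaugeConfig LatticeRep gaugeTransform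
  IsGaugeInvariant)

variable {d L : ℕ} {G : Type*} [Group G]

/-! ## Paths from the base point and the holonomy gauge -/

section Gauge

/-- The reversed word from its endpoint carries the inverse holonomy (endpoint form). -/
theorem wordHolonomy_reverse_of_endpoint (U : GaugeConfig d L G) {x y : Site d L} {w : Word d}
    (h : Word.endpoint x w = y) : wordHolonomy U y w.reverse = (wordHolonomy U x w)⁻¹ := by
  subst h
  exact wordHolonomy_reverse U x w

variable [NeZero L]

/-- **A lattice word from the base point `0` to `x`** (a choice; the torus is connected by words).
[folklore] -/
def basePath (x : Site d L) : Word d := Classical.choose (exists_word_endpoint (0 : Site d L) x)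

/-- `basePath x` ends at `x`. -/
@[simp] theorem endpoint_basePath (x : Site d L) : Word.endpoint (0 : Site d L) (basePath x) = x :=
  Classical.choose_spec (exists_word_endpoint (0 : Site d L) x)

/-- **The closed word at `0` through the link `e = (x, i)`**: out along `basePath x`, across `e`,
back along `basePath (x + e_i)` reversed. [folklore] -/
def edgeLoop (e : Edge d L) : Word d :=
  basePath e.1 ++ [Step.fwd e.2] ++ (basePath (e.1.shift e.2)).reverse

/-- `edgeLoop e` is closed at `0`. -/
@[simp] theorem endpoint_edgeLoop (e : Edge d L) : Word.endpoint (0 : Site d L) (edgeLoop e) = 0 := by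
  rw [edgeLoop, Word.endpoint_append, Word.endpoint_append, endpoint_basePath]
  have h : Word.endpoint e.1 [Step.fwd e.2] = e.1.shift e.2 := rfl
  rw [h]
  have h3 := Word.endpoint_reverse (0 : Site d L) (basePath (e.1.shift e.2))
  rwa [endpoint_basePath] at h3

/-- **The holonomy gauge transformation** of `U`: at the site `x`, the holonomy of `U` along
`basePath x`. [folklore] -/
def pathGauge (U : GaugeConfig d L G) : Site d L → G := fun x => wordHolonomy U 0 (basePath x)

/-- ★ **In the holonomy gauge every link variable is a closed-word holonomy at the base point**:
`(U^{pathGauge U})_e = hol_0(edgeLoop e)(U)`. [folklore] -/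
theorem gaugeTransform_pathGauge_apply (U : GaugeConfig d L G) (e : Edge d L) :
    gaugeTransform (pathGauge U) U e = wordHolonomy U 0 (edgeLoop e) := by
  rw [edgeLoop, wordHolonomy_append, wordHolonomy_append, Word.endpoint_append, endpoint_basePath]
  have h1 : Word.endpoint e.1 [Step.fwd e.2] = e.1.shift e.2 := rfl
  have h2 : wordHolonomy U e.1 [Step.fwd e.2] = U e := by
    simp only [wordHolonomy_cons, wordHolonomy_nil, stepHolonomy_fwd, mul_one]
  rw [h1, h2, wordHolonomy_reverse_of_endpoint U (endpoint_basePath (e.1.shift e.2))]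
  rfl

variable [TopologicalSpace G] [IsTopologicalGroup G]

/-- **The holonomy gauge as a continuous self-map** `U ↦ U^{pathGauge U}` of the configurations.
[folklore] -/
def pathGaugeCM : C(GaugeConfig d L G, GaugeConfig d L G) where
  toFun U := gaugeTransform (pathGauge U) U
  continuous_toFun := by
    have hc : ∀ (x : Site d L) (w : Word d), Continuous fun U : GaugeConfig d L G => wordHolonomy U x w := by
      intro x w
      induction w generalizing x with
      | nil => simpa using continuous_const
      | cons s w ih =>
        simp only [wordHolonomy_cons]
        refine Continuous.mul ?_ (ih (s.apply x))
        cases s with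
        | fwd μ => exact continuous_apply _
        | bwd μ => exact (continuous_apply _).inv
    refine continuous_pi fun e => ?_
    simp only [gaugeTransform_pathGauge_apply]
    exact hc 0 (edgeLoop e)

/-- `pathGaugeCM` evaluated. -/
@[simp] theorem pathGaugeCM_apply (U : GaugeConfig d L G) :
    pathGaugeCM (G := G) U = gaugeTransform (pathGauge U) U := rfl

/-- **Gauge-invariant observables do not see the holonomy gauge**: `f ∘ pathGauge = f`. -/
theorem comp_pathGaugeCM_eq_of_isGaugeInvariant {β : Type*} [TopologicalSpace β]
    {f : C(GaugeConfig d L G, β)} (hf : IsGaugeInvariant (⇑f)) : f.comp pathGaugeCM = f := by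
  ext U
  exact hf (pathGauge U) U

end Gauge

/-! ## Complex polynomial observables and the line algebra at the base point -/

section Algebras

variable [TopologicalSpace G] (r : LatticeRep G)

/-- **Complex matrix entry of a link variable** `U ↦ ρ(U_e)_{ab}`. [folklore] -/
def entryC (e : Edge d L) (a b : Fin r.N) : C(GaugeConfig d L G, ℂ) :=
  ⟨fun U => r.ρ (U e) a b, (r.continuous.comp (continuous_apply e)).matrix_elem a b⟩

/-- `entryC` evaluated. -/
@[simp] theorem entryC_apply (e : Edge d L) (a b : Fin r.N) (U : GaugeConfig d L G) :
    entryC r e a b U = r.ρ (U e) a b := rfl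

/-- **The complex polynomial observables**: the unital `ℂ`-subalgebra of `C(U, ℂ)` generated by the
matrix entries of the link variables and their complex conjugates. [folklore] -/
def polyAlgebraC : Subalgebra ℂ C(GaugeConfig d L G, ℂ) :=
  Algebra.adjoin ℂ ({f | ∃ e a b, f = entryC (d := d) (L := L) r e a b} ∪
    {f | ∃ e a b, f = star (entryC (d := d) (L := L) r e a b)})

variable [IsTopologicalGroup G]

/-- **The line algebra at `x`**: the unital `ℂ`-subalgebra generated by the ENTRIES of the
holonomies of the closed words at `x`. [folklore] -/
def lineAlgebraC (x : Site d L) : Subalgebra ℂ C(GaugeConfig d L G, ℂ) :=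
  Algebra.adjoin ℂ {f | ∃ (w : Word d) (a b : Fin r.N), Word.endpoint x w = x ∧ f = lineC r x w a b}

/-- Entries of closed-word holonomies are in the line algebra. -/
theorem lineC_mem_lineAlgebraC (x : Site d L) {w : Word d} (hw : Word.endpoint x w = x) (a b : Fin r.N) :
    lineC r x w a b ∈ lineAlgebraC (d := d) (L := L) r x :=
  Algebra.subset_adjoin ⟨w, a, b, hw, rfl⟩

/-- ★ **Unitarity closes the line algebra under conjugation**: for a closed word,
`conj ρ(hol_x w)_{ab} = ρ(hol_x w⁻¹)_{ba}`. -/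
theorem star_lineC_of_closed (x : Site d L) {w : Word d} (hw : Word.endpoint x w = x) (a b : Fin r.N) :
    star (lineC r x w a b) = (lineC r x w.reverse b a : C(GaugeConfig d L G, ℂ)) := by
  ext U
  change (starRingEnd ℂ) (r.ρ (wordHolonomy U x w) a b) = r.ρ (wordHolonomy U x w.reverse) b a
  rw [wordHolonomy_reverse_of_endpoint U hw, rho_inv_apply]

variable [NeZero L]

/-- In the holonomy gauge a matrix entry is a closed-word line entry at the base point. -/
theorem entryC_comp_pathGaugeCM (e : Edge d L) (a b : Fin r.N) :
    (entryC r e a b).comp pathGaugeCM = (lineC r 0 (edgeLoop e) a b : C(GaugeConfig d L G, ℂ)) := by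
  ext U
  change r.ρ (gaugeTransform (pathGauge U) U e) a b = r.ρ (wordHolonomy U 0 (edgeLoop e)) a b
  rw [gaugeTransform_pathGauge_apply]

/-- ★★ **In the holonomy gauge every complex polynomial observable is a polynomial in the entries
of closed-word holonomies at the base point**: `F ∘ pathGauge ∈ lineAlgebraC r 0` for every
`F ∈ polyAlgebraC r`. [folklore] -/
theorem comp_pathGaugeCM_mem_lineAlgebraC {F : C(GaugeConfig d L G, ℂ)} (hF : F ∈ polyAlgebraC r) :
    F.comp pathGaugeCM ∈ lineAlgebraC (d := d) (L := L) r 0 := by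
  let ψ : C(GaugeConfig d L G, ℂ) →ₐ[ℂ] C(GaugeConfig d L G, ℂ) :=
    ContinuousMap.compRightAlgHom ℂ ℂ (pathGaugeCM (G := G) (d := d) (L := L))
  have hψ : ∀ g : C(GaugeConfig d L G, ℂ), ψ g = g.comp pathGaugeCM := fun g => rfl
  rw [← hψ]
  change F ∈ Subalgebra.comap ψ (lineAlgebraC r 0)
  refine (Algebra.adjoin_le ?_ : polyAlgebraC r ≤ Subalgebra.comap ψ (lineAlgebraC r 0)) hF
  rintro g (⟨e, a, b, rfl⟩ | ⟨e, a, b, rfl⟩)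
  · rw [SetLike.mem_coe, Subalgebra.mem_comap, hψ, entryC_comp_pathGaugeCM]
    exact lineC_mem_lineAlgebraC r 0 (endpoint_edgeLoop e) a b
  · rw [SetLike.mem_coe, Subalgebra.mem_comap, hψ]
    have e1 : (star (entryC r e a b)).comp pathGaugeCM =
        star ((entryC r e a b).comp (pathGaugeCM (G := G) (d := d) (L := L))) := rfl
    rw [e1, entryC_comp_pathGaugeCM, star_lineC_of_closed r 0 (endpoint_edgeLoop e)]
    exact lineC_mem_lineAlgebraC r 0 (by
      rw [← endpoint_edgeLoop (L := L) e, Word.endpoint_reverse, endpoint_edgeLoop]) b a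

/-- ★★ **A gauge-invariant complex polynomial observable lies in the line algebra at the base
point** (it equals its own composition with the holonomy gauge). -/
theorem mem_lineAlgebraC_of_isGaugeInvariant {F : C(GaugeConfig d L G, ℂ)} (hF : F ∈ polyAlgebraC r)
    (hFi : IsGaugeInvariant (⇑F)) : F ∈ lineAlgebraC (d := d) (L := L) r 0 := by
  rw [← comp_pathGaugeCM_eq_of_isGaugeInvariant hFi]
  exact comp_pathGaugeCM_mem_lineAlgebraC r hF

end Algebras

end Summit.QuantumFields.GaugeBoot

end
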